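import Mathlib

/-!
# Degree of a determinant along a two-sided low-rank perturbation

Helper file for item `PauliBandLimit` of route `PauliWegnerSea` (stmt-QuantumFields-11514) of
`Summits/QuantumFields/QCD`; pure linear algebra over a field `K`, no lattice objects.

* `det_eq_zero_of_rows_eq_of_rank_lt`: if the rows of `N` indexed by a finset `S` are the
  corresponding rows of `B` and `#S > rank B`, then `det N = 0`.
* `det_add_smul_add_smul_of_rank_le`: if `rank B ≤ r` and `rank C ≤ s`, there are coefficients
  `c₀, c₁, …` such that `det (A + z • B + w • C) = w ^ s * ∑_{k ≤ r + s} c_k z ^ k` for all `z w`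
  with `z w = 1` — i.e. on the circle `w = z⁻¹` the determinant is a Laurent polynomial with
  exponents in `[-s, r]`.  Proof: expand `det` multilinearly in the rows
  (`MultilinearMap.map_sum` / `map_smul_univ` on `Matrix.detRowAlternating`); a term taking more
  than `r` rows from `B` or more than `s` rows from `C` vanishes by the first lemma; regroup the
  surviving monomials `z^a w^b` (`a ≤ r`, `b ≤ s`) as `w^s z^{a+s-b}`.
* `rank_add_le'`, `rank_mul_fin_two_le`: subadditivity of `Matrix.rank` and `rank (P Q) ≤ 2` for a
  product through `Fin 2` (thin wrappers around Mathlib's `LinearMap.range_add_le`,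
  `Matrix.rank_mul_le_left`, `Matrix.rank_le_card_width`).
-/

open scoped BigOperators
open Matrix Finset

namespace Summit.QuantumFields.QCD.Theorems.PauliBandLimit

variable {K : Type*} [Field K] {n : Type*} [Fintype n] [DecidableEq n]

/-- If the rows of `N` indexed by `S` are the corresponding rows of `B` and `S` has more than
`rank B` elements, then `det N = 0` (those rows are linearly dependent). [folklore] -/
theorem det_eq_zero_of_rows_eq_of_rank_lt (B N : Matrix n n K) (S : Finset n)
    (hS : ∀ i ∈ S, N i = B i) (hr : B.rank < S.card) : N.det = 0 := by
  by_contra h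
  have hU : IsUnit N := (Matrix.isUnit_iff_isUnit_det N).2 (isUnit_iff_ne_zero.2 h)
  have hli : LinearIndependent K N.row := Matrix.linearIndependent_rows_iff_isUnit.2 hU
  have hliS : LinearIndependent K (fun i : S => B (i : n)) := by
    have h' := hli.comp (Subtype.val : S → n) Subtype.val_injective
    convert h' using 1
    funext i
    exact (hS i i.2).symm
  have h1 : Fintype.card S ≤ (Set.range fun i : S => B (i : n)).finrank K :=
    linearIndependent_iff_card_le_finrank_span.1 hliS
  have h2 : (Set.range fun i : S => B (i : n)).finrank K ≤ (Set.range B.row).finrank K :=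
    Set.finrank_mono (Set.range_comp_subset_range (Subtype.val : S → n) B)
  have h3 : (Set.range B.row).finrank K = B.rank := (B.rank_eq_finrank_span_row).symm
  rw [Fintype.card_coe] at h1
  omega

/-- **Degree of a determinant along a two-sided rank perturbation.**  If `rank B ≤ r` and
`rank C ≤ s`, then for `z w` with `z w = 1` the determinant `det (A + z B + w C)` equals
`w ^ s · p(z)` for a polynomial `p` of degree `≤ r + s` whose coefficients do not depend on `z, w`:
expanding `det` multilinearly in the rows, a term with more than `r` rows taken from `B` (or more
than `s` from `C`) vanishes. [folklore] -/
theorem det_add_smul_add_smul_of_rank_le (A B C : Matrix n n K) {r s : ℕ} (hB : B.rank ≤ r)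
    (hC : C.rank ≤ s) :
    ∃ c : ℕ → K, ∀ z w : K, z * w = 1 →
      (A + z • B + w • C).det = w ^ s * ∑ k ∈ Finset.range (r + s + 1), c k * z ^ k := by
  classical
  -- the three candidate rows at each index, the pure determinants and the row counts
  set h : n → Fin 3 → (n → K) := fun i => ![A i, B i, C i] with hh
  set D : (n → Fin 3) → K := fun τ => Matrix.det (Matrix.of fun i => h i (τ i)) with hD
  set a : (n → Fin 3) → ℕ := fun τ => #{i | τ i = 1} with ha
  set b : (n → Fin 3) → ℕ := fun τ => #{i | τ i = 2} with hb
  set good : Finset (n → Fin 3) := {τ | a τ ≤ r ∧ b τ ≤ s} with hgood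
  refine ⟨fun k => ∑ τ ∈ good with a τ + s - b τ = k, D τ, fun z w hzw => ?_⟩
  -- Step 1: multilinear expansion in the rows
  have step1 : (A + z • B + w • C).det = ∑ τ : n → Fin 3, z ^ a τ * w ^ b τ * D τ := by
    have hM : (A + z • B + w • C : Matrix n n K) =
        fun i => ∑ j : Fin 3, (![(1 : K), z, w] j) • h i j := by
      funext i
      simp [hh, Fin.sum_univ_three]
      rfl
    have hexp := MultilinearMap.map_sum
      (Matrix.detRowAlternating : (n → K) [⋀^n]→ₗ[K] K).toMultilinearMap
      (fun i j => (![(1 : K), z, w] j) • h i j)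
    simp only [AlternatingMap.coe_multilinearMap] at hexp
    change Matrix.detRowAlternating _ = _
    rw [hM, hexp]
    refine Finset.sum_congr rfl fun τ _ => ?_
    have hsm := MultilinearMap.map_smul_univ
      (Matrix.detRowAlternating : (n → K) [⋀^n]→ₗ[K] K).toMultilinearMap
      (fun i => ![(1 : K), z, w] (τ i)) (fun i => h i (τ i))
    simp only [AlternatingMap.coe_multilinearMap] at hsm
    rw [hsm, smul_eq_mul]
    have hprod : ∏ i, ![(1 : K), z, w] (τ i) = z ^ a τ * w ^ b τ := by
      rw [← Finset.prod_fiberwise' Finset.univ τ (![(1 : K), z, w])]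
      simp only [Finset.prod_const]
      rw [Fin.prod_univ_three]
      simp [ha, hb]
    rw [hprod]
    rfl
  -- Step 2: vanishing outside `good`
  have step2 : ∀ τ, τ ∉ good → D τ = 0 := by
    intro τ hτ
    simp only [hgood, Finset.mem_filter, Finset.mem_univ, true_and, not_and_or, not_le] at hτ
    rcases hτ with hτ | hτ
    · refine det_eq_zero_of_rows_eq_of_rank_lt B _ {i | τ i = 1} (fun i hi => ?_)
        (lt_of_le_of_lt hB hτ)
      simp only [Finset.mem_filter, Finset.mem_univ, true_and] at hi
      funext j
      simp [hh, hi]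
    · refine det_eq_zero_of_rows_eq_of_rank_lt C _ {i | τ i = 2} (fun i hi => ?_)
        (lt_of_le_of_lt hC hτ)
      simp only [Finset.mem_filter, Finset.mem_univ, true_and] at hi
      funext j
      simp [hh, hi]
  -- Step 3: regroup by the exponent `a τ + s - b τ`
  have step3 : ∑ τ : n → Fin 3, z ^ a τ * w ^ b τ * D τ =
      ∑ τ ∈ good, w ^ s * (D τ * z ^ (a τ + s - b τ)) := by
    rw [← Finset.sum_subset (Finset.subset_univ good)
      (fun τ _ hτ => by rw [step2 τ hτ, mul_zero])]
    refine Finset.sum_congr rfl fun τ hτ => ?_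
    simp only [hgood, Finset.mem_filter, Finset.mem_univ, true_and] at hτ
    obtain ⟨-, hbs⟩ := hτ
    have key : z ^ (a τ + s - b τ) * w ^ s = z ^ a τ * w ^ b τ := by
      obtain ⟨t, ht⟩ := Nat.exists_eq_add_of_le hbs
      rw [ht, show a τ + (b τ + t) - b τ = a τ + t by omega, pow_add, pow_add]
      calc z ^ a τ * z ^ t * (w ^ b τ * w ^ t)
          = z ^ a τ * w ^ b τ * (z * w) ^ t := by rw [mul_pow]; ring
        _ = z ^ a τ * w ^ b τ := by rw [hzw, one_pow, mul_one]
    rw [← key]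
    ring
  have hmaps : ∀ τ ∈ good, a τ + s - b τ ∈ Finset.range (r + s + 1) := by
    intro τ hτ
    simp only [hgood, Finset.mem_filter, Finset.mem_univ, true_and] at hτ
    simp only [Finset.mem_range]
    omega
  rw [step1, step3, ← Finset.mul_sum, ← Finset.sum_fiberwise_of_maps_to hmaps]
  congr 1
  refine Finset.sum_congr rfl fun k _ => ?_
  rw [Finset.sum_mul]
  refine Finset.sum_congr rfl fun τ hτ => ?_
  simp only [Finset.mem_filter] at hτ
  rw [hτ.2]


/-- Subadditivity of the rank of matrices. [folklore] -/
theorem rank_add_le' {K : Type*} [Field K] {m n : Type*} [Fintype m] [Fintype n] [DecidableEq n]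
    (A B : Matrix m n K) : (A + B).rank ≤ A.rank + B.rank := by
  unfold Matrix.rank
  rw [Matrix.mulVecLin_add]
  exact (Submodule.finrank_mono (LinearMap.range_add_le _ _)).trans
    (Submodule.finrank_add_le_finrank_add_finrank _ _)

/-- A product through `Fin 2` has rank at most two. [folklore] -/
theorem rank_mul_fin_two_le {K : Type*} [Field K] {m n : Type*} [Fintype m] [Fintype n]
    [DecidableEq n] (P : Matrix m (Fin 2) K) (Q : Matrix (Fin 2) n K) : (P * Q).rank ≤ 2 := by
  refine (Matrix.rank_mul_le_left P Q).trans ?_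
  simpa using Matrix.rank_le_card_width P

end Summit.QuantumFields.QCD.Theorems.PauliBandLimit
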